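import Summits.AnomalousDissipation.AnomalousDissipation.Theorems.SawtoothPulseCascadeK1LocalisedCascadeFarModes

/-!
# K1loc, line `Spectral` — S-D (thin start): CHANNEL SUMS TRUNCATED TO A FINITE WINDOW

Helper file of the prover lane on the crux `K1LocalisedCascade` (stmt-AnomalousDissipation-19491), route
`SawtoothPulseCascade` (glue seat k1loc-p3).  The S-D target `hch` of `K1Ledger.From.k1Localised_of_thin_strip_cone`
(`…LedgerThinTarget`) is a bound on two INFINITE channel sums `Σ' k, [P k]·‖𝓕a_n(k)‖²` (strip `P = [|k₀| ≤ L′]`, off-cone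
`P = [13/10·|k₀| ≤ γ|k₁|]`), while the fibre-ledger window lemma (`…FibreWindow.sum_window_sq_norm_comp_shearMap_le`,
ad-sawtooth-k1loc-p1 g6) bounds FINITE windows `Σ_{k ∈ W}`.  This file is the truncation glue:
* `tsum_indicator_le_sum_box_add_far` (pure `ℓ²`): for a non-negative summable weight `c`, any decidable `P` and `N : ℕ`,
  `Σ' [P]c ≤ Σ_{k ∈ Box_N, P k} c(k) + Σ'[N+1 ≤ |k₀|]c + Σ'[N+1 ≤ |k₁|]c`, `Box_N = Fintype.piFinset (fun _ => Finset.Icc (−N) N)`;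
* `tsum_indicator_le_sum_box_add_gradient`: for a smooth real field with `|∂₀θ| ≤ D₀`, `|∂₁θ| ≤ D₁` the two far terms are
  `≤ (Dⱼ/(2π(N+1)))²` (`…FarModes.tsum_far_le_of_abs_partialDeriv_le`); for the inviscid iterate `Dⱼ ≤ 2π(1+γ)^{2n}`
  (`…IterateGradient`), so `N ≍ (1+γ)^{2n}/√ε` makes them `≤ ε`: every channel of `hch` is a finite window up to `ε`.
WHAT THIS IS NOT: no statement about the cascade.
[cite: Grafakos2014, Prop. 3.2.7 (3)] [problem: turb]
-/

-- `Summit.<Summit>.<Problem>`: single-conjunct summit, the duplicate namespace segment is deliberate.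
set_option linter.dupNamespace false

noncomputable section

namespace Summit.AnomalousDissipation.AnomalousDissipation.Theorems.SawtoothPulseCascade.K1Start

open MeasureTheory Set Filter Topology UnitAddTorus Function
open Literature.Analysis.FunctionSpaces Literature.Analysis.FunctionSpaces.Torus

/-- **Outside the box one coordinate is far**: for `k ∉ Box_N` (`Box_N = Π Icc(−N, N)`), `N + 1 ≤ |k₀|` or `N + 1 ≤ |k₁|`.
[folklore] -/
theorem far_of_not_mem_box {N : ℕ} {k : Fin 2 → ℤ} (hk : k ∉ Fintype.piFinset fun _ : Fin 2 => Finset.Icc (-(N : ℤ)) N) :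
    ((N : ℝ) + 1 ≤ |((k 0 : ℤ) : ℝ)|) ∨ ((N : ℝ) + 1 ≤ |((k 1 : ℤ) : ℝ)|) := by
  rw [Fintype.mem_piFinset] at hk
  obtain ⟨j, hj⟩ := not_forall.mp hk
  rw [Finset.mem_Icc, not_and_or, not_le, not_le] at hj
  have hfar : (N : ℝ) + 1 ≤ |((k j : ℤ) : ℝ)| := by
    have h1 : (N : ℤ) + 1 ≤ |k j| := by
      rcases hj with h | h
      · rw [abs_of_neg (by omega)]; omega
      · rw [abs_of_pos (by omega)]; omega
    exact_mod_cast h1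
  fin_cases j
  · exact Or.inl hfar
  · exact Or.inr hfar

/-- **Channel sum truncated to a box**: for a non-negative summable weight `c`, a decidable predicate `P` and `N : ℕ`,
`Σ' k, [P k]·c(k) ≤ Σ_{k ∈ Box_N, P k} c(k) + Σ' k, [N+1 ≤ |k₀|]·c(k) + Σ' k, [N+1 ≤ |k₁|]·c(k)`. [folklore] -/
theorem tsum_indicator_le_sum_box_add_far (P : (Fin 2 → ℤ) → Prop) [DecidablePred P] (N : ℕ) {c : (Fin 2 → ℤ) → ℝ}
    (hc : Summable c) (hc0 : ∀ k, 0 ≤ c k) :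
    ∑' k : Fin 2 → ℤ, (if P k then (1 : ℝ) else 0) * c k ≤
      ∑ k ∈ (Fintype.piFinset fun _ : Fin 2 => Finset.Icc (-(N : ℤ)) N).filter P, c k +
        (∑' k : Fin 2 → ℤ, (if (N : ℝ) + 1 ≤ |((k 0 : ℤ) : ℝ)| then (1 : ℝ) else 0) * c k +
          ∑' k : Fin 2 → ℤ, (if (N : ℝ) + 1 ≤ |((k 1 : ℤ) : ℝ)| then (1 : ℝ) else 0) * c k) := by
  set W : Finset (Fin 2 → ℤ) := (Fintype.piFinset fun _ : Fin 2 => Finset.Icc (-(N : ℤ)) N).filter P with hW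
  have hsI : ∀ (p : (Fin 2 → ℤ) → Prop) [DecidablePred p], Summable fun k => (if p k then (1 : ℝ) else 0) * c k := by
    intro p _
    refine Summable.of_nonneg_of_le (fun k => mul_nonneg (by split_ifs <;> norm_num) (hc0 k)) (fun k => ?_) hc
    split_ifs <;> simp [hc0 k]
  -- the window part as a finitely supported series
  have hWsum : HasSum (fun k : Fin 2 → ℤ => (if k ∈ W then (1 : ℝ) else 0) * c k) (∑ k ∈ W, c k) := by
    have h : HasSum (fun k : Fin 2 → ℤ => (if k ∈ W then (1 : ℝ) else 0) * c k)
        (∑ k ∈ W, (if k ∈ W then (1 : ℝ) else 0) * c k) :=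
      hasSum_sum_of_ne_finset_zero (fun k hk => by rw [if_neg hk, zero_mul])
    rwa [Finset.sum_congr rfl (fun k hk => by rw [if_pos hk, one_mul] :
      ∀ k ∈ W, (if k ∈ W then (1 : ℝ) else 0) * c k = c k)] at h
  have h0 := hsI (fun k => (N : ℝ) + 1 ≤ |((k 0 : ℤ) : ℝ)|)
  have h1 := hsI (fun k => (N : ℝ) + 1 ≤ |((k 1 : ℤ) : ℝ)|)
  rw [← hWsum.tsum_eq, ← (h0.hasSum.add h1.hasSum).tsum_eq, ← (hWsum.summable.hasSum.add (h0.add h1).hasSum).tsum_eq]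
  have hle : ∀ k : Fin 2 → ℤ, (if P k then (1 : ℝ) else 0) * c k ≤
      (if k ∈ W then (1 : ℝ) else 0) * c k +
        ((if (N : ℝ) + 1 ≤ |((k 0 : ℤ) : ℝ)| then (1 : ℝ) else 0) * c k +
          (if (N : ℝ) + 1 ≤ |((k 1 : ℤ) : ℝ)| then (1 : ℝ) else 0) * c k) := by
    intro k
    have hck := hc0 k
    by_cases hP : P k
    · rw [if_pos hP]
      by_cases hbox : k ∈ Fintype.piFinset fun _ : Fin 2 => Finset.Icc (-(N : ℤ)) N
      · have hkW : k ∈ W := by rw [hW, Finset.mem_filter]; exact ⟨hbox, hP⟩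
        rw [if_pos hkW]
        have h2 : 0 ≤ (if (N : ℝ) + 1 ≤ |((k 0 : ℤ) : ℝ)| then (1 : ℝ) else 0) * c k :=
          mul_nonneg (by split_ifs <;> norm_num) hck
        have h3 : 0 ≤ (if (N : ℝ) + 1 ≤ |((k 1 : ℤ) : ℝ)| then (1 : ℝ) else 0) * c k :=
          mul_nonneg (by split_ifs <;> norm_num) hck
        linarith
      · have h2 : 0 ≤ (if k ∈ W then (1 : ℝ) else 0) * c k := mul_nonneg (by split_ifs <;> norm_num) hck
        rcases far_of_not_mem_box hbox with h | h
        · rw [if_pos h]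
          have h3 : 0 ≤ (if (N : ℝ) + 1 ≤ |((k 1 : ℤ) : ℝ)| then (1 : ℝ) else 0) * c k :=
            mul_nonneg (by split_ifs <;> norm_num) hck
          linarith
        · rw [if_pos h]
          have h3 : 0 ≤ (if (N : ℝ) + 1 ≤ |((k 0 : ℤ) : ℝ)| then (1 : ℝ) else 0) * c k :=
            mul_nonneg (by split_ifs <;> norm_num) hck
          linarith
    · rw [if_neg hP, zero_mul]
      exact add_nonneg (mul_nonneg (by split_ifs <;> norm_num) hck)
        (add_nonneg (mul_nonneg (by split_ifs <;> norm_num) hck) (mul_nonneg (by split_ifs <;> norm_num) hck))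
  exact Summable.tsum_le_tsum hle (hsI P) (hWsum.summable.add (h0.add h1))

/-- **Channel sum = finite window up to the gradient tails**: for a smooth real field `θ` on `T²` with `|∂₀θ| ≤ D₀`,
`|∂₁θ| ≤ D₁`, any decidable `P` and `N : ℕ`,
`Σ' k, [P k]·‖𝓕θ(k)‖² ≤ Σ_{k ∈ Box_N, P k} ‖𝓕θ(k)‖² + (D₀/(2π(N+1)))² + (D₁/(2π(N+1)))²`. [cite: Grafakos2014, Prop. 3.2.7 (3)] -/
theorem tsum_indicator_le_sum_box_add_gradient {θ : UnitAddTorus (Fin 2) → ℝ} (hθ : IsSmooth θ) (P : (Fin 2 → ℤ) → Prop)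
    [DecidablePred P] (N : ℕ) {D₀ D₁ : ℝ} (hD₀ : ∀ x, |partialDeriv 0 θ x| ≤ D₀) (hD₁ : ∀ x, |partialDeriv 1 θ x| ≤ D₁) :
    ∑' k : Fin 2 → ℤ, (if P k then (1 : ℝ) else 0) * ‖mFourierCoeff (fun x => (θ x : ℂ)) k‖ ^ 2 ≤
      ∑ k ∈ (Fintype.piFinset fun _ : Fin 2 => Finset.Icc (-(N : ℤ)) N).filter P, ‖mFourierCoeff (fun x => (θ x : ℂ)) k‖ ^ 2 +
        ((D₀ / (2 * Real.pi * ((N : ℝ) + 1))) ^ 2 + (D₁ / (2 * Real.pi * ((N : ℝ) + 1))) ^ 2) := by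
  have hθc : Continuous (fun x => (θ x : ℂ)) := Complex.continuous_ofReal.comp hθ.continuous
  have hsq := hasSum_sq_mFourierCoeff_of_continuous hθc
  have hN : (0 : ℝ) < (N : ℝ) + 1 := by positivity
  have h := tsum_indicator_le_sum_box_add_far P N hsq.summable (fun k => sq_nonneg _)
  have hfar₀ := tsum_far_le_of_abs_partialDeriv_le hθ (0 : Fin 2) hN hD₀
  have hfar₁ := tsum_far_le_of_abs_partialDeriv_le hθ (1 : Fin 2) hN hD₁
  linarith

end Summit.AnomalousDissipation.AnomalousDissipation.Theorems.SawtoothPulseCascade.K1Start
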